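import Summits.ResolutionOfSingularities.ResolutionOfSingularities.Theorems.EquisingularLiftEquisingularLiftNatVertexExitChartC
import Mathlib.RingTheory.RegularLocalRing.Polynomial
import HarnessLib

/-!
# [OURS · L1 W4.5(b) · EL♮] PHASE-B FINISHING CHART: after an `m = 2` ribbon the transversal model of the strict transform is the non-normal
# surface `𝒴 = {u·y₁² + y₃² = 0}`; the finishing type-(II′) centre has trace `(ȳ₁, ȳ₃)`, and the chart `ȳ₁ ≠ 0` of `Bl_{(ȳ₁,ȳ₃)} 𝒴` is an
# affine plane — regular (crux `EquisingularLiftNat` = stmt-ResolutionOfSingularities-20038; PARENT ≥ 4 band / kill test #50, COMPANIONS.md §I.3)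

HONEST FRAMING. OURS (cell res-hironaka, crux chain w45b, slot W4.5(b)); NOT a statement of any manuscript; replaces the role of NOTHING in the
manuscript; AI-written, AI review is weaker than expert review. Helper `--supports stmt-ResolutionOfSingularities-20038 --as helper`. Object (β)
«phase-B finishing-centre charts» of res-L1-w45b-plan-1's shelf (CHAIN v7.30 §4/§7 (j)), memo `L/res-L1-w45b-lead-1/COMPANIONS.md` §I.3 («phase B is
never locally obstructed»).

THE MODEL (DSHARP-VOID §2 / COMPANIONS §I.3, transversal to the avatar, tangent conic normalised to `q = x₁x₂ + x₃²`, ribbon direction `x₃`, `m = 2`).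
After the ribbon touch the strict transform of `Y` near the ruled `v`-centre `Z` is, modulo `ϖ` and after eliminating the chart coordinate `w` by the
strict-transform equation, `𝒴 = Spec k[y₁, u, y₃]/(u y₁² + y₃²)` — singular and NON-NORMAL along `Z = {y₁ = y₃ = 0}` (`(y₃/y₁)² = −u`). A
finishing type-(II′) centre (`V(y₁ + αw, y₃ + βw)`, `β² ≠ α`, m′ = 2 — or its `m′ = 3` variant) has trace `(ȳ₁, ȳ₃)·𝒪_𝒴` at the generic point of `Z`;
the blow-up of `𝒴` along `(ȳ₁, ȳ₃)` normalises it.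

THE THEOREM (model form over any commutative ring `k`; chart `ȳ₁`): `ψ : k[y₁, t] → B := 𝒪_𝒴[(ȳ₁, ȳ₃)/ȳ₁]`, `t ↦ ȳ₃/ȳ₁`, is a BIJECTION for `k` a
domain (`ψ_bijective`), with the graph relations `ȳ₃ = ȳ₁·t` (`algebraMap_y₃_eq`) and `ū = −t²` (`algebraMap_u_eq`) in `B`; for a field, `B` is a
regular ring (`isRegularRing_B`) — the chart of the finishing blow-up is the affine plane `Spec k[y₁, t]` (= (the conic `u + t² = 0`) × (the `y₁`-line)).
Proof: onto by the two relations and `blowupAlgebra.eval_surjective`; injective by the left inverse `Λ : 𝒪_𝒴[1/ȳ₁] → k[y₁,t][1/y₁]`, `u ↦ −t²`,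
`y₃ ↦ y₁t` (kills `u y₁² + y₃²`). The chart `ȳ₃` (`k[s, u, y₃]/(u s² + 1)`, a localised plane) is the symmetric sequel, not filed.
Coordinates: `X 0, X 1, X 2 = y₁, u, y₃` on `𝔸³`; `X 0, X 1 = y₁, t` on the model. Template: `…NatVertexExitChartC` (p547268).

References: memo COMPANIONS.md §I.3, DSHARP-VOID.md §2; [StacksProject, Tags 052P/052Q/080E]; [GortzWedhorn2020, (13.19) p. 415].
-/

set_option linter.dupNamespace false -- mandated namespace `Summit.<Summit>.<Problem>` of this single-conjunct summit

noncomputable section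

universe u

open Literature.AlgebraicGeometry.Resolution MvPolynomial

namespace Summit.ResolutionOfSingularities.ResolutionOfSingularities.Cruxes.EquisingularLiftNat.Sections

namespace PhaseBFinish

/-! ## Identities in any commutative ring -/

/-- `c e = 1`, `a c² = −v²` ⇒ `a = −(v e)²`. [folklore] -/
theorem rel_sq {L : Type*} [CommRing L] (a c v e : L) (he : c * e = 1) (h : a * c ^ 2 = -(v ^ 2)) : a = -((v * e) ^ 2) := by
  calc a = a * (c * e) ^ 2 := by rw [he, one_pow, mul_one]
    _ = a * c ^ 2 * e ^ 2 := by ring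
    _ = -(v ^ 2) * e ^ 2 := by rw [h]
    _ = -((v * e) ^ 2) := by ring

variable (k : Type u) [CommRing k]

/-- The equation `u y₁² + y₃²` of the model surface `𝒴` (coordinates `X 0, X 1, X 2 = y₁, u, y₃`). OURS bookkeeping. -/
def rel : MvPolynomial (Fin 3) k := X 1 * X 0 ^ 2 + X 2 ^ 2

/-- `𝒪_𝒴 = k[y₁, u, y₃]/(u y₁² + y₃²)`. OURS bookkeeping. -/
abbrev OY : Type u := MvPolynomial (Fin 3) k ⧸ Ideal.span {rel k}

/-- `k[y₁,u,y₃] → 𝒪_𝒴`. OURS bookkeeping. -/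
abbrev mkY : MvPolynomial (Fin 3) k →+* OY k := Ideal.Quotient.mk (Ideal.span {rel k})

/-- The trace `(ȳ₁, ȳ₃)` of the finishing centre on `𝒴`. OURS bookkeeping. -/
def tr : Fin 2 → OY k := ![mkY k (X 0), mkY k (X 2)]

/-- The chart `B = 𝒪_𝒴[(ȳ₁, ȳ₃)/ȳ₁] ⊆ 𝒪_𝒴[1/ȳ₁]`. OURS bookkeeping. -/
abbrev B : Subalgebra (OY k) (Localization.Away (tr k 0)) := blowupAlgebra (Ideal.span (Set.range (tr k))) (tr k 0)

/-- The values of the model coordinates `y₁, t` in `B`: `ȳ₁`, `ȳ₃/ȳ₁`. OURS bookkeeping. -/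
def cv : Fin 2 → B k := ![algebraMap (OY k) (B k) (mkY k (X 0)), blowupAlgebra.frac (tr k) 0 1]

/-- **`ψ : k[y₁, t] → B`**, `t ↦ ȳ₃/ȳ₁`. OURS bookkeeping. -/
def ψ : MvPolynomial (Fin 2) k →+* B k :=
  MvPolynomial.eval₂Hom ((algebraMap (OY k) (B k)).comp ((mkY k).comp MvPolynomial.C)) (cv k)

/-! ## The relations -/

/-- The model equation in `𝒪_𝒴`: `ū ȳ₁² = −ȳ₃²`. [folklore] -/
theorem u_mul_y₁_sq : mkY k (X 1) * mkY k (X 0) ^ 2 = -(mkY k (X 2) ^ 2) := by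
  rw [← map_pow, ← map_pow, ← map_mul, ← map_neg, Ideal.Quotient.eq]
  have h : (X 1 * X 0 ^ 2 - -(X 2 ^ 2) : MvPolynomial (Fin 3) k) = rel k := by rw [rel]; ring
  rw [h]
  exact Ideal.subset_span rfl

/-- `ȳ₁ · (1/ȳ₁) = 1` in `𝒪_𝒴[1/ȳ₁]`. [folklore] -/
theorem y₁_mul_invSelf :
    algebraMap (OY k) (Localization.Away (tr k 0)) (tr k 0) * IsLocalization.Away.invSelf (tr k 0) = 1 :=
  IsLocalization.Away.mul_invSelf (S := Localization.Away (tr k 0)) (tr k 0)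

/-- `ψ` on constants. [folklore] -/
theorem ψ_C (a : k) : ψ k (C a) = algebraMap (OY k) (B k) (mkY k (C a)) := MvPolynomial.eval₂Hom_C _ _ a

/-- `ψ y₁ = ȳ₁`. [folklore] -/
theorem ψ_X₀ : ψ k (X 0) = algebraMap (OY k) (B k) (mkY k (X 0)) := MvPolynomial.eval₂Hom_X' _ _ 0

/-- `ψ t = ȳ₃/ȳ₁`. [folklore] -/
theorem ψ_X₁ : ψ k (X 1) = blowupAlgebra.frac (tr k) 0 1 := MvPolynomial.eval₂Hom_X' _ _ 1

/-- **First graph relation: `ȳ₃ = ȳ₁ · t` in `B`.** [folklore] -/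
theorem algebraMap_y₃_eq : algebraMap (OY k) (B k) (mkY k (X 2)) = ψ k (X 0) * ψ k (X 1) := by
  rw [ψ_X₀, ψ_X₁]
  apply Subtype.ext
  rw [Subalgebra.coe_mul, blowupAlgebra.coe_frac]
  exact VertexExit.rel_mul _ _ _ (y₁_mul_invSelf k)

/-- **Second graph relation: `ū = −t²` in `B`** — the strict transform's chart is the conic `u + t² = 0` times the `y₁`-line. [folklore] -/
theorem algebraMap_u_eq : algebraMap (OY k) (B k) (mkY k (X 1)) = -(ψ k (X 1) ^ 2) := by
  rw [ψ_X₁]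
  apply Subtype.ext
  rw [Subalgebra.coe_neg, Subalgebra.coe_pow, blowupAlgebra.coe_frac]
  refine rel_sq _ _ _ _ (y₁_mul_invSelf k) ?_
  change algebraMap (OY k) (Localization.Away (tr k 0)) (mkY k (X 1)) * algebraMap (OY k) _ (mkY k (X 0)) ^ 2 =
    -(algebraMap (OY k) _ (mkY k (X 2)) ^ 2)
  rw [← map_pow (algebraMap (OY k) (Localization.Away (tr k 0))), ← map_pow (algebraMap (OY k) (Localization.Away (tr k 0))),
    ← map_mul (algebraMap (OY k) (Localization.Away (tr k 0))), ← map_neg (algebraMap (OY k) (Localization.Away (tr k 0))), u_mul_y₁_sq]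

/-! ## `ψ` is onto -/

/-- Every `x̄ⱼ` lies in the image of `ψ`. [folklore] -/
theorem algebraMap_X_mem_range (j : Fin 3) : algebraMap (OY k) (B k) (mkY k (X j)) ∈ (ψ k).range := by
  match j with
  | ⟨0, _⟩ => exact ⟨X 0, ψ_X₀ k⟩
  | ⟨1, _⟩ =>
    exact (show algebraMap (OY k) (B k) (mkY k (X 1)) ∈ (ψ k).range from
      ⟨-(X 1 ^ 2), by rw [map_neg, map_pow, ← algebraMap_u_eq]⟩)
  | ⟨2, _⟩ =>
    exact (show algebraMap (OY k) (B k) (mkY k (X 2)) ∈ (ψ k).range from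
      ⟨X 0 * X 1, by rw [map_mul, ← algebraMap_y₃_eq]⟩)

/-- Every constant lies in the image of `ψ`. [folklore] -/
theorem algebraMap_mem_range (y : OY k) : algebraMap (OY k) (B k) y ∈ (ψ k).range := by
  obtain ⟨G, rfl⟩ := Ideal.Quotient.mk_surjective y
  induction G using MvPolynomial.induction_on with
  | C a => exact ⟨C a, ψ_C k a⟩
  | add p q hp hq => rw [map_add, map_add]; exact add_mem hp hq
  | mul_X p j hp => rw [map_mul, map_mul]; exact mul_mem hp (algebraMap_X_mem_range k j)

/-- Every fraction lies in the image of `ψ`. [folklore] -/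
theorem frac_mem_range (j : Fin 2) : blowupAlgebra.frac (tr k) 0 j ∈ (ψ k).range := by
  have h0 : blowupAlgebra.frac (tr k) 0 0 ∈ (ψ k).range := by
    refine ⟨1, ?_⟩
    rw [map_one]
    apply Subtype.ext
    rw [blowupAlgebra.coe_frac, OneMemClass.coe_one]
    exact (y₁_mul_invSelf k).symm
  match j with
  | ⟨0, _⟩ => exact h0
  | ⟨1, _⟩ => exact ⟨X 1, ψ_X₁ k⟩

/-- **`ψ` is onto.** [folklore] -/
theorem ψ_surjective : Function.Surjective (ψ k) := by
  intro z
  obtain ⟨F, rfl⟩ := blowupAlgebra.eval_surjective (tr k) 0 z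
  suffices h : (blowupAlgebra.eval (tr k) 0 F) ∈ (ψ k).range by exact h
  induction F using MvPolynomial.induction_on with
  | C y => rw [blowupAlgebra.eval_C]; exact algebraMap_mem_range k y
  | add p q hp hq => rw [map_add]; exact add_mem hp hq
  | mul_X p j hp => rw [map_mul, blowupAlgebra.eval_X]; exact mul_mem hp (frac_mem_range k j.1)

/-! ## `ψ` is injective -/

/-- The inverse substitution `y₁ ↦ y₁, u ↦ −t², y₃ ↦ y₁ t`. OURS bookkeeping. -/
def lamVal : Fin 3 → MvPolynomial (Fin 2) k := ![X 0, -(X 1 ^ 2), X 0 * X 1]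

/-- `λ(y₁) = y₁`. OURS bookkeeping. -/
theorem lamVal_0 : lamVal k 0 = X 0 := rfl

/-- `λ(u) = −t²`. OURS bookkeeping. -/
theorem lamVal_1 : lamVal k 1 = -(X 1 ^ 2) := rfl

/-- `λ(y₃) = y₁ t`. OURS bookkeeping. -/
theorem lamVal_2 : lamVal k 2 = X 0 * X 1 := rfl

/-- The substitution kills `u y₁² + y₃²`. [folklore] -/
theorem span_rel_le_ker : Ideal.span {rel k} ≤ RingHom.ker (MvPolynomial.eval₂Hom MvPolynomial.C (lamVal k)) := by
  rw [Ideal.span_le, Set.singleton_subset_iff, SetLike.mem_coe, RingHom.mem_ker, rel]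
  simp only [map_add, map_mul, map_pow, MvPolynomial.eval₂Hom_X', lamVal_0, lamVal_1, lamVal_2]
  ring

/-- `λ : 𝒪_𝒴 → k[y₁,t][1/y₁]`. OURS bookkeeping. -/
def lam : OY k →+* Localization.Away (X 0 : MvPolynomial (Fin 2) k) :=
  Ideal.Quotient.lift (Ideal.span {rel k})
    ((algebraMap (MvPolynomial (Fin 2) k) (Localization.Away (X 0 : MvPolynomial (Fin 2) k))).comp
      (MvPolynomial.eval₂Hom MvPolynomial.C (lamVal k)))
    (fun a ha => by rw [RingHom.comp_apply, RingHom.mem_ker.mp (span_rel_le_ker k ha), map_zero])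

/-- `λ` on classes. [folklore] -/
theorem lam_mkY (F : MvPolynomial (Fin 3) k) :
    lam k (mkY k F) = algebraMap (MvPolynomial (Fin 2) k) (Localization.Away (X 0 : MvPolynomial (Fin 2) k))
      (MvPolynomial.eval₂Hom MvPolynomial.C (lamVal k) F) :=
  Ideal.Quotient.lift_mk _ _ _

/-- `λ(ȳ₁) = y₁`. [folklore] -/
theorem lam_tr_zero : lam k (tr k 0) =
    algebraMap (MvPolynomial (Fin 2) k) (Localization.Away (X 0 : MvPolynomial (Fin 2) k)) (X 0) := by
  change lam k (mkY k (X 0)) = _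
  rw [lam_mkY, MvPolynomial.eval₂Hom_X', lamVal_0]

/-- `λ(ȳ₁)` is a unit. [folklore] -/
theorem isUnit_lam_tr_zero : IsUnit (lam k (tr k 0)) := by
  rw [lam_tr_zero]
  exact IsLocalization.Away.algebraMap_isUnit (X 0 : MvPolynomial (Fin 2) k)

/-- **`Λ : 𝒪_𝒴[1/ȳ₁] → k[y₁,t][1/y₁]`**, the left inverse of `ψ` after localisation. OURS bookkeeping. -/
def Λ : Localization.Away (tr k 0) →+* Localization.Away (X 0 : MvPolynomial (Fin 2) k) :=
  IsLocalization.Away.lift (tr k 0) (isUnit_lam_tr_zero k)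

/-- `Λ` extends `λ`. [folklore] -/
theorem Λ_algebraMap (y : OY k) : Λ k (algebraMap (OY k) (Localization.Away (tr k 0)) y) = lam k y :=
  IsLocalization.Away.lift_eq (tr k 0) (isUnit_lam_tr_zero k) y

/-- `Λ` on a fraction `r/ȳ₁`: if `λ r = t · λ ȳ₁` then `Λ (r/ȳ₁) = t`. [folklore] -/
theorem Λ_frac {r : OY k} {t : Localization.Away (X 0 : MvPolynomial (Fin 2) k)} (h : lam k r = t * lam k (tr k 0)) :
    Λ k (algebraMap (OY k) (Localization.Away (tr k 0)) r * IsLocalization.Away.invSelf (tr k 0)) = t := by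
  refine (isUnit_lam_tr_zero k).mul_left_injective ?_
  dsimp only
  rw [← h, ← Λ_algebraMap k (tr k 0), ← map_mul, mul_assoc, mul_comm (IsLocalization.Away.invSelf (tr k 0)),
    y₁_mul_invSelf, mul_one, Λ_algebraMap]

/-- **`Λ ∘ ψ = (k[y₁,t] → k[y₁,t][1/y₁])`.** [folklore] -/
theorem Λ_comp_ψ :
    (Λ k).comp (((B k).val : B k →+* Localization.Away (tr k 0)).comp (ψ k)) =
      algebraMap (MvPolynomial (Fin 2) k) (Localization.Away (X 0 : MvPolynomial (Fin 2) k)) := by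
  refine MvPolynomial.ringHom_ext (fun a => ?_) (fun j => ?_)
  · rw [RingHom.comp_apply, RingHom.comp_apply, ψ_C]
    change Λ k (algebraMap (OY k) (Localization.Away (tr k 0)) (mkY k (C a))) = _
    rw [Λ_algebraMap, lam_mkY, MvPolynomial.eval₂Hom_C]
  · rw [RingHom.comp_apply, RingHom.comp_apply]
    match j with
    | ⟨0, _⟩ =>
      change Λ k ((ψ k (X 0) : B k) : Localization.Away (tr k 0)) = algebraMap _ _ (X 0)
      rw [ψ_X₀]
      change Λ k (algebraMap (OY k) (Localization.Away (tr k 0)) (mkY k (X 0))) = _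
      rw [Λ_algebraMap, lam_mkY, MvPolynomial.eval₂Hom_X']
      rfl
    | ⟨1, _⟩ =>
      change Λ k ((ψ k (X 1) : B k) : Localization.Away (tr k 0)) = algebraMap _ _ (X 1)
      rw [ψ_X₁, blowupAlgebra.coe_frac]
      refine Λ_frac k ?_
      change lam k (mkY k (X 2)) = _
      rw [lam_tr_zero, lam_mkY, MvPolynomial.eval₂Hom_X', ← map_mul, lamVal_2, mul_comm]

/-- **`ψ` is injective** (`k` a domain). [folklore] -/
theorem ψ_injective [IsDomain k] : Function.Injective (ψ k) := by
  have hinj : Function.Injective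
      (algebraMap (MvPolynomial (Fin 2) k) (Localization.Away (X 0 : MvPolynomial (Fin 2) k))) :=
    IsLocalization.injective _ (powers_le_nonZeroDivisors_of_noZeroDivisors (MvPolynomial.X_ne_zero 0))
  rw [← Λ_comp_ψ, RingHom.coe_comp, RingHom.coe_comp] at hinj
  exact hinj.of_comp.of_comp

/-! ## Conclusion -/

/-- **PHASE-B FINISHING CHART (model form): `ψ : k[y₁, t] → B = 𝒪_𝒴[(ȳ₁,ȳ₃)/ȳ₁]` is a bijection** — the chart `ȳ₁ ≠ 0` of the blow-up of the
non-normal model surface `𝒴 = {u y₁² + y₃² = 0}` along the finishing trace `(ȳ₁, ȳ₃)` is the affine plane, the graph `ȳ₃ = ȳ₁ t`, `ū = −t²`. OURS. -/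
theorem ψ_bijective [IsDomain k] : Function.Bijective (ψ k) :=
  ⟨ψ_injective k, ψ_surjective k⟩

/-- **The chart `B` is a regular ring** (over a field): the finishing type-(II′) touch normalises the ruled double point on this chart —
«phase B is never locally obstructed» (COMPANIONS.md §I.3), model form. OURS. -/
theorem isRegularRing_B (K : Type u) [Field K] : IsRegularRing (B K) :=
  IsRegularRing.of_ringEquiv (RingEquiv.ofBijective (ψ K) (ψ_bijective K))

end PhaseBFinish

end Summit.ResolutionOfSingularities.ResolutionOfSingularities.Cruxes.EquisingularLiftNat.Sections
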